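import Summits.ResolutionOfSingularities.ResolutionOfSingularities.Theorems.WeightedInvariantLocalWeightedDropNCEndgameOrdLift

/-!
# W4.3 `LocalWeightedDrop` — THE ORDINAL ENDGAME ONE DIMENSION UP (every dimension): an order-`1` germ times a boundary monomial in
# `m + 2` variables is transfinitely NC-winnable, given the transfinite NC game in `m + 1` variables

Crux item stmt-ResolutionOfSingularities-8899 `WeightedInvariant.LocalWeightedDrop` (route `ResolutionOfSingularities/WeightedInvariant`), ENGINE
skeleton v32 (ddb48572591139d5), residuals `stub_wildWideApexFourStartsWon` (W4|₄) and `stub_spaceNCRankDrop`; strategist line `directrix-cut`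
(res-L1-w43-strat-1 g7, `L/res-L1-w43-strat-1/g7/DIRECTRIX-CUT.md`, sub-skeleton `endord3_split.lean`), stub E (`stub_endOrdThree`), port target E2
`stub_orderOneReduceThree` and the composition `endOrdThree_of_graphLift` — here for EVERY `m`.  [OURS · L1 W4.3 · seat res-D-pv-006; def-free;
R8's normal form (N) (`NCTransport.exists_winsIn_orderOne_mul`, res-L1-w43-strat-1's text, `…NCEndgameOrderOne`) one block up with `WinsOrd`; NOT a
statement of any manuscript; AI-produced, gate-checked, weaker than expert review.]

* `exists_winsOrd_orderOne_mul (horacle) (f u) (v) (hf : f.order = 1) (hu : u(0) ≠ 0) : ∃ α, WinsOrd GermIsNC α (u · f · x^v)` in `m + 2`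
  variables, from the ORACLE `horacle : every non-zero (m+1)-variable germ is transfinitely NC-winnable`.  (N): a linear letter `x_j` of `f`
  with `v_j = 0` makes the position NC at once (`germIsNC_of_smooth_mul_unitMonomial`); else swap `x_j` to the last slot (a legal coordinate
  change, `winsOrd_germIsNC_of_subst`), Weierstrass-prepare in degree `1` (`WeierstrassForm.exists_weierstrass`): up to a unit
  (`winsOrd_germIsNC_unit_mul`) the position is the graph position `x_R ^ a · ηm^L · (x_R + φ^L)` with `ηm` a monomial; `φ = 0`: unit monomial, NC;
  else THE GRAPH LIFT `winsOrd_graphRel` (`…NCEndgameOrdLift`) with the oracle's value for `ηm · φ`.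
* `exists_winsOrd_orderOne_mul_prod` — the Finset form `f · ∏_{l ∈ E} x_l`; `exists_winsOrd_orderOne_mul_prod_of_rankDrop` — the same from ONE
  ordinal rank lowered by some move in `m + 1` variables (`winsOrd_of_rankDrop`): **`RD k m → EndOrd k (m + 1)`** of line `directrix-cut`, unfolded.
* `orderOneReduceThree` = strat-1's `stub_orderOneReduceThree` statement VERBATIM; `endOrdThree_of_door` = `stub_endOrdThree`'s content from the
  door `stub_spaceNCRankDrop` (its v32 text as the hypothesis, verbatim): `∀ p k …, EndOrd k 3` unfolded.
-/

noncomputable section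

open Literature.AlgebraicGeometry.Resolution

set_option linter.dupNamespace false -- mandated namespace of this single-conjunct summit

namespace Summit.ResolutionOfSingularities.ResolutionOfSingularities.Theorems

namespace NCTransport

open MvPowerSeries TameFourTupleDrop

variable {k : Type} [Field k]

/-- Block arithmetic `k⟦x₀, …, x_m | x_{m+1}⟧`: left block of size `m + 1`, right block `{x_{m+1}}` of size `rz + 1 = 1`. -/
theorem hm1 (m : ℕ) : m + rz + 1 = m + 1 := rfl

/-- A block exponent vector (generic blocks): a left monomial times a power of `x_R`. -/
theorem prod_pow_blockFun' {m M : ℕ} (hM : m + rz + 1 = M) (ε : Fin (m + 1) → ℕ) (N : ℕ) :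
    (∏ l, (X l : MvPowerSeries (Fin (M + 1)) k) ^ blockFun hM ε (fun _ => N) l) =
      rename (bL hM) (∏ i, X i ^ ε i) * X (bR hM 0) ^ N := by
  rw [prod_block hM, prod_rz, map_prod]
  simp only [blockFun_bL, blockFun_bR, map_pow, rename_X]

/-- The right letter of `hm1 m` is the last variable. -/
theorem bR_hm1_zero (m : ℕ) : bR (hm1 m) 0 = Fin.last (m + 1) := Fin.ext (by simp)

/-- **THE ORDINAL ENDGAME ONE DIMENSION UP (every `m`).**  Given that every non-zero `(m+1)`-variable germ is transfinitely NC-winnable, an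
order-`1` germ in `m + 2` variables times any monomial in the coordinate letters (times a unit) is transfinitely NC-winnable. -/
theorem exists_winsOrd_orderOne_mul {m : ℕ}
    (horacle : ∀ b : MvPowerSeries (Fin (m + 1)) k, b ≠ 0 → ∃ β : Ordinal.{0}, WinsOrd (m := m) GermIsNC β b)
    (f u : MvPowerSeries (Fin (m + 1 + 1)) k) (v : Fin (m + 1 + 1) → ℕ) (hf : f.order = 1) (hu : constantCoeff u ≠ 0) :
    ∃ α : Ordinal.{0}, WinsOrd (m := m + 1) GermIsNC α (u * f * ∏ l, X l ^ v l) := by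
  classical
  obtain ⟨-, hfc, j, hj⟩ := exists_coeff_single_ne_zero_of_order_eq_one hf
  by_cases hvj : v j = 0
  · -- a linear letter of `f` is unflagged: the position is already NC
    have h := germIsNC_of_smooth_mul_unitMonomial j hfc hj hu 1 hvj
    rw [pow_one] at h
    exact ⟨0, winsOrd_of_terminal h 0⟩
  -- (N) permute the linear letter `x_j` to the last slot and Weierstrass-prepare in degree `1`
  obtain ⟨π, hπ⟩ : ∃ π : Equiv.Perm (Fin (m + 1 + 1)), π = Equiv.swap j (Fin.last (m + 1)) := ⟨_, rfl⟩
  have hπj : π j = Fin.last (m + 1) := by rw [hπ, Equiv.swap_apply_left]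
  have hππ : ∀ l, π (π l) = l := fun l => by rw [hπ]; exact Equiv.swap_apply_self _ _ _
  have hf'c : constantCoeff (rename π f) = 0 := by rw [constantCoeff_rename]; exact hfc
  have hf'2 : coeff (Finsupp.single (Fin.last (m + 1)) 1) (rename π f) ≠ 0 := by
    have h := coeff_single_rename_self π.toEmbedding f j
    have h' : coeff (Finsupp.single (Fin.last (m + 1)) 1) (rename π f) = coeff (Finsupp.single j 1) f := by
      rw [← h, show (Fin.last (m + 1) : Fin (m + 1 + 1)) = π.toEmbedding j from hπj.symm]
      rfl
    rw [h']
    exact hj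
  obtain ⟨H, A, hH, -, hW⟩ := WeierstrassForm.exists_weierstrass (m := m + 1) (d := 1) (rename π f)
    (fun n hn => by
      obtain rfl : n = 0 := by omega
      rw [Finsupp.single_zero, MvPowerSeries.coeff_zero_eq_constantCoeff]
      exact hf'c) hf'2
  -- `rename π f = H · (x_R + φ^L)`
  have hemb : (⇑(Fin.succAboveEmb (Fin.last (m + 1))) : Fin (m + 1) → Fin (m + 1 + 1)) = ⇑(bL (hm1 m)) := by
    funext i
    show (Fin.last (m + 1)).succAbove i = bL (hm1 m) i
    rw [Fin.succAbove_last]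
    exact Fin.ext rfl
  have hren : ∀ p : MvPowerSeries (Fin (m + 1)) k, rename (Fin.succAboveEmb (Fin.last (m + 1))) p = rename (bL (hm1 m)) p :=
    fun p => by rw [rename_eq_subst, rename_eq_subst, hemb]
  have hW' : rename π f = H * (X (bR (hm1 m) 0) + rename (bL (hm1 m)) (A 0)) := by
    rw [hW, Fin.sum_univ_one, hren, bR_hm1_zero]
    simp only [Fin.val_zero, pow_zero, pow_one, mul_one]
  -- the flagged letters: a left monomial `ηm` and `x_R ^ a`
  have hmon1 : rename π (∏ l, (X l : MvPowerSeries (Fin (m + 1 + 1)) k) ^ v l) = ∏ l, X l ^ v (π l) := by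
    rw [map_prod]
    simp only [map_pow, rename_X]
    calc (∏ l, (X (π l) : MvPowerSeries (Fin (m + 1 + 1)) k) ^ v l)
        = ∏ l, (fun l' => (X l' : MvPowerSeries (Fin (m + 1 + 1)) k) ^ v (π l')) (π l) :=
          Finset.prod_congr rfl fun l _ => by simp only [hππ]
      _ = ∏ l, X l ^ v (π l) := Equiv.prod_comp π (fun l' => (X l' : MvPowerSeries (Fin (m + 1 + 1)) k) ^ v (π l'))
  have hmon : rename π (∏ l, (X l : MvPowerSeries (Fin (m + 1 + 1)) k) ^ v l) =
      rename (bL (hm1 m)) (∏ i, X i ^ v (π (bL (hm1 m) i))) * X (bR (hm1 m) 0) ^ v (π (bR (hm1 m) 0)) := by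
    rw [hmon1, prod_block (hm1 m) (fun l => (X l : MvPowerSeries (Fin (m + 1 + 1)) k) ^ v (π l)), prod_rz, map_prod]
    simp only [map_pow, rename_X]
  have hηm : (∏ i, (X i : MvPowerSeries (Fin (m + 1)) k) ^ v (π (bL (hm1 m) i))) ≠ 0 :=
    Finset.prod_ne_zero_iff.mpr fun i _ => pow_ne_zero _ (MvPowerSeries.prime_X' k i).ne_zero
  have hunit : constantCoeff (rename π u * H) ≠ 0 := by
    rw [map_mul, constantCoeff_rename]; exact mul_ne_zero hu hH
  -- the permuted position is a unit times a graph position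
  have hpos : rename π (u * f * ∏ l, X l ^ v l) = (rename π u * H) *
      (X (bR (hm1 m) 0) ^ v (π (bR (hm1 m) 0)) * relBinom (hm1 m) 1 (∏ i, X i ^ v (π (bL (hm1 m) i))) 1 (A 0)) := by
    rw [map_mul, map_mul, hW', hmon, relBinom_one_eta_one']
    ring
  have key : ∃ α : Ordinal.{0}, WinsOrd (m := m + 1) GermIsNC α ((rename π u * H) *
      (X (bR (hm1 m) 0) ^ v (π (bR (hm1 m) 0)) * relBinom (hm1 m) 1 (∏ i, X i ^ v (π (bL (hm1 m) i))) 1 (A 0))) := by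
    by_cases hφ : A 0 = 0
    · -- `rename π f = H · x_R`: the position is a unit monomial
      refine ⟨0, winsOrd_of_terminal ?_ 0⟩
      have heq : (rename π u * H) * (X (bR (hm1 m) 0) ^ v (π (bR (hm1 m) 0)) *
          relBinom (hm1 m) 1 (∏ i, X i ^ v (π (bL (hm1 m) i))) 1 (A 0)) =
          (rename π u * H) * ∏ l, X l ^ blockFun (hm1 m) (fun i => v (π (bL (hm1 m) i))) (fun _ => v (π (bR (hm1 m) 0)) + 1) l := by
        rw [prod_pow_blockFun', relBinom_one_eta_one', hφ]
        simp only [map_zero, add_zero, pow_succ]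
        ring
      rw [heq]
      exact germIsNC_unitMonomial hunit _
    · obtain ⟨β, hβ⟩ := horacle ((∏ i, (X i : MvPowerSeries (Fin (m + 1)) k) ^ v (π (bL (hm1 m) i))) * A 0) (mul_ne_zero hηm hφ)
      exact ⟨_, winsOrd_germIsNC_unit_mul _ hunit (winsOrd_graphRel (hm1 m) β _ _ (A 0) hηm hφ hβ)⟩
  obtain ⟨α, hα⟩ := key
  rw [← hpos, rename_eq_subst] at hα
  exact ⟨α, winsOrd_germIsNC_of_subst (fun l => constantCoeff_X _) (isUnit_det_linMat_perm π) hα⟩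

/-- THE FLAGGED FORM (`EndOrd`, unfolded): an order-`1` germ in `m + 2` variables times the product of any set of coordinate letters is
transfinitely NC-winnable, given the oracle in `m + 1` variables. -/
theorem exists_winsOrd_orderOne_mul_prod {m : ℕ}
    (horacle : ∀ b : MvPowerSeries (Fin (m + 1)) k, b ≠ 0 → ∃ β : Ordinal.{0}, WinsOrd (m := m) GermIsNC β b)
    (f : MvPowerSeries (Fin (m + 1 + 1)) k) (hf : f.order = 1) (E : Finset (Fin (m + 1 + 1))) :
    ∃ α : Ordinal.{0}, WinsOrd (m := m + 1) GermIsNC α (f * ∏ l ∈ E, X l) := by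
  classical
  obtain ⟨α, hα⟩ := exists_winsOrd_orderOne_mul horacle f 1 (fun l => if l ∈ E then 1 else 0) hf
    (by rw [map_one]; exact one_ne_zero)
  refine ⟨α, ?_⟩
  have h : (∏ l, (X l : MvPowerSeries (Fin (m + 1 + 1)) k) ^ (if l ∈ E then 1 else 0)) = ∏ l ∈ E, X l := by
    rw [← Fintype.prod_ite_mem E (fun l => (X l : MvPowerSeries (Fin (m + 1 + 1)) k))]
    exact Finset.prod_congr rfl fun l _ => by split_ifs <;> simp
  rwa [one_mul, h] at hα

/-- **`RD k m → EndOrd k (m + 1)` (line `directrix-cut`, unfolded): ONE ordinal rank on `(m+1)`-variable germs lowered by some move at every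
answer from every non-zero non-NC germ makes every order-`1` germ times boundary letters in `m + 2` variables transfinitely NC-winnable.** -/
theorem exists_winsOrd_orderOne_mul_prod_of_rankDrop {m : ℕ}
    (hRD : ∃ ρ : MvPowerSeries (Fin (m + 1)) k → Ordinal.{0}, ∀ b : MvPowerSeries (Fin (m + 1)) k, b ≠ 0 → ¬ GermIsNC b →
      ∃ (Φ : Fin (m + 1) → MvPowerSeries (Fin (m + 1)) k) (w : Fin (m + 1) → ℕ),
        IsCountMove Φ w ∧ MoveClause b Φ w (fun b' => ρ b' < ρ b))
    (f : MvPowerSeries (Fin (m + 1 + 1)) k) (hf : f.order = 1) (E : Finset (Fin (m + 1 + 1))) :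
    ∃ α : Ordinal.{0}, WinsOrd (m := m + 1) GermIsNC α (f * ∏ l ∈ E, X l) := by
  obtain ⟨ρ, hρ⟩ := hRD
  exact exists_winsOrd_orderOne_mul_prod (winsOrd_of_rankDrop ρ hρ) f hf E

/-! ## The instances at `(m, M) = (2, 3)`: strat-1's `stub_orderOneReduceThree` and `stub_endOrdThree` from the door -/

/-- **`stub_orderOneReduceThree` OF LINE `directrix-cut` (res-L1-w43-strat-1 g7, `endord3_split.lean`), its statement verbatim** (the first
hypothesis — the graph lift E1 — is not even used: it is the theorem `graphRelOrdThree`). -/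
theorem orderOneReduceThree : ∀ (k : Type) [Field k],
    (∀ (a : ℕ) (η h : MvPowerSeries (Fin (2 + 1)) k), η ≠ 0 → h ≠ 0 →
      (∃ β : Ordinal.{0}, WinsOrd (m := 2) GermIsNC β (η * h)) →
        ∃ α : Ordinal.{0}, WinsOrd (m := 3) GermIsNC α (X (bR h203 0) ^ a * relBinom h203 1 η 1 h)) →
    (∀ b : MvPowerSeries (Fin (2 + 1)) k, b ≠ 0 → ∃ β : Ordinal.{0}, WinsOrd (m := 2) GermIsNC β b) →
    ∀ (f u : MvPowerSeries (Fin (3 + 1)) k) (v : Fin (3 + 1) → ℕ), f.order = 1 → constantCoeff u ≠ 0 →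
      ∃ α : Ordinal.{0}, WinsOrd (m := 3) GermIsNC α (u * f * ∏ l, X l ^ v l) :=
  fun _ _ _ horacle f u v hf hu => exists_winsOrd_orderOne_mul horacle f u v hf hu

/-- **`stub_endOrdThree` OF LINE `directrix-cut` FROM THE DOOR**: the registered door stub `stub_spaceNCRankDrop`'s statement (skeleton v32,
verbatim, as the hypothesis `hdoor`) gives the ordinal endgame rung `EndOrd k 3` (unfolded) for every prime `p` and every algebraically closed
field of characteristic `p`. -/
theorem endOrdThree_of_door
    (hdoor : ∀ (p : ℕ), p.Prime → ∀ (k : Type) [Field k] [CharP k p] [IsAlgClosed k],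
      ∃ ρ : MvPowerSeries (Fin 3) k → Ordinal.{0}, ∀ b : MvPowerSeries (Fin 3) k, b ≠ 0 → ¬ TameFourTupleDrop.GermIsNC b →
        ∃ (Φ : Fin 3 → MvPowerSeries (Fin 3) k) (w : Fin 3 → ℕ),
          TameFourTupleDrop.IsCountMove (m := 2) Φ w ∧ TameFourTupleDrop.MoveClause (m := 2) b Φ w (fun b' => ρ b' < ρ b)) :
    ∀ (p : ℕ), p.Prime → ∀ (k : Type) [Field k] [CharP k p] [IsAlgClosed k],
      ∀ f : MvPowerSeries (Fin (3 + 1)) k, f.order = 1 → ∀ E : Finset (Fin (3 + 1)),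
        ∃ α : Ordinal.{0}, WinsOrd (m := 3) GermIsNC α (f * ∏ l ∈ E, X l) :=
  fun p hp k _ _ _ f hf E => exists_winsOrd_orderOne_mul_prod_of_rankDrop (hdoor p hp k) f hf E

end NCTransport

end Summit.ResolutionOfSingularities.ResolutionOfSingularities.Theorems
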